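import Literature.NumberTheory.Transcendental.KaehlerHodgeStarTypeProofs
import Literature.Geometry.Kaehler.HodgeStarBasisProofs
import HarnessLib

/-!
# Orthogonality of the bidegree decomposition for a Hermitian metric (Huybrechts, Lemma 1.2.24 (i))

Theorems-only companion of `Literature/NumberTheory/Transcendental/KaehlerHodge.lean` (C12) and of
`KaehlerHodgeStarTypeProofs.lean`, supplying the second pointwise ingredient of Huybrechts' proof
that `∂̄* = -⋆∂⋆` is the `L²`-adjoint of `∂̄` (Huybrechts (2005), Lemma 3.2.3, p. 126, proved in
`KaehlerHodgeAdjointProofs.lean`): the **orthogonality of the `U(1)`-weight (bidegree)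
decomposition** for the Hermitian extension of a Hermitian metric (Lemma 1.2.24 (i), p. 33;
Prop. 3.2.2 (ii), p. 125), together with the weight bookkeeping of `⋆`, `∂` and `∂̄`.

Recall (`ComplexForms.lean`) that a complex `k`-form `α` has *type `(p,q)`* iff `p + q = k` and it
has `U(1)`-*weight* `w = p - q`: `α(x)(e^{iθ}v) = e^{iwθ} α(x)(v)` for the rotations
`e^{iθ} = Literature.NumberTheory.Transcendental.tangentRotate E x θ`. All statements below are
phrased with an integer weight `w` (no natural subtraction), pointwise, for any Riemannian metric
on the real tangent bundle that is Hermitian in the instance form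
`hH : ∀ x v w, ⟪J v, J w⟫ = ⟪v, w⟫` (for a metric term `g` installed by
`letI : RiemannianBundle _ := ⟨g.toRiemannianMetric⟩` this is literally
`g.toRiemannianMetric.IsHermitian`).

## Main statements (all proved; no named fact is introduced)

* `Literature.Geometry.Kaehler.alternatingFormInner_compContinuousLinearMap_of_inner_eq`: the
  inner product induced on real `k`-forms (`alternatingFormInner`, Warner, GTM 94, Ex. 2.13) is
  invariant under pull-back by a linear isometry (basis independence,
  `alternatingFormInner_eq_sum_holds`); hence under the rotations `e^{iθ}` of a Hermitian metric
  (`alternatingFormInner_comp_tangentRotate`, via `inner_tangentRotate_tangentRotate`).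
* `inner_re_im_eq_zero_of_weight_ne` — **Lemma 1.2.24 (i)**: if `α`, `β` have weights `w ≠ w'`
  at `x`, the pointwise Hermitian product
  `⟨α, β⟩ = (⟨Re α, Re β⟩ + ⟨Im α, Im β⟩) + i (⟨Re α, Im β⟩ - ⟨Im α, Re β⟩)` (conjugate-linear in
  the first slot, the integrand of `MForm.cl2Inner`) vanishes, i.e. both real combinations do.
* `cHodgeStar_apply_comp_tangentRotate_of_weight` — **Lemma 1.2.24 (ii)** in weight form: the
  `ℂ`-linear Hodge star preserves weights (integer-weight version of
  `IsOfType.cHodgeStar_apply_comp_tangentRotate` of `KaehlerHodgeStarTypeProofs.lean`).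
* `apply_eq_zero_of_weight_of_forall_ne`: a `k`-form whose weight is not an admissible frequency
  (`|w| > k` or `w ≢ k (mod 2)`) vanishes (parity-sharp form of
  `eq_zero_of_forall_apply_comp_tangentRotate`); `eq_zero_or_exists_isOfType_of_weight`: a form of
  weight `w` is `0` or of some type `(p,q)`, `p - q = w`.
* `dolbeault_apply_comp_tangentRotate_of_weight`, `dolbeaultBar_apply_comp_tangentRotate_of_weight`:
  **`∂` raises and `∂̄` lowers the weight by one** (Huybrechts (2005), Lemma 1.3.6 / Def. 3.1.3,
  `∂ : A^{p,q} → A^{p+1,q}`, `∂̄ : A^{p,q} → A^{p,q+1}`; from `IsOfType.dolbeault/dolbeaultBar`).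

## Proof of the orthogonality (as printed, Huybrechts p. 33: "follows directly from Lemma 1.2.16",
i.e. from the `U(1)`-invariance of the Hermitian form)

With `u = e^{iwθ}`, `u' = e^{iw'θ}`: `Re (α ∘ e^{iθ}) = Re u · Re α - Im u · Im α`,
`Im (α ∘ e^{iθ}) = Re u · Im α + Im u · Re α`; the four real pairings `⟨Re α, Re β⟩, …` are
invariant under `e^{iθ}` (isometry of the Hermitian metric), and expanding bilinearly gives
`⟨α, β⟩ = conj(u) u' ⟨α, β⟩`; for `θ = π / (w' - w)` one has `conj(u) u' = e^{iπ} = -1`, whence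
`⟨α, β⟩ = 0`.

## References

* D. Huybrechts, *Complex Geometry. An Introduction*, Universitext, Springer (2005): §1.2,
  Lemma 1.2.24 (i)–(ii), p. 33; Lemma 1.3.6; §3.1, Def. 3.1.3, p. 115; §3.2, Prop. 3.2.2 (ii),
  p. 125, Lemma 3.2.3, p. 126.
* C. Voisin, *Hodge Theory and Complex Algebraic Geometry I* (2002), §2.3.1; §5.1.1.
* F. W. Warner, *Foundations of Differentiable Manifolds and Lie Groups*, GTM 94 (1983), Ch. 2,
  Ex. 13 (the induced inner product on forms).
-/

noncomputable section

open scoped Manifold ContDiff Topology ComplexConjugate RealInnerProductSpace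
open Bundle Module Set Finset

/-! ### The induced inner product on forms is invariant under isometries -/

namespace Literature.Geometry.Kaehler

section Isometry

variable {V : Type*} [NormedAddCommGroup V] [InnerProductSpace ℝ V] {n : ℕ}

/-- The multi-index tuples of a mapped orthonormal basis: `(b.map φ)_s = φ ∘ b_s`. Deliberate
dot-notation extension of Mathlib's `OrthonormalBasis` (as `OrthonormalBasis.multiIndex` itself,
`HodgeStar.lean`). [folklore] -/
theorem _root_.OrthonormalBasis.multiIndex_map (b : OrthonormalBasis (Fin n) ℝ V)
    (φ : V ≃ₗᵢ[ℝ] V) {k : ℕ} (s : Set.powersetCard (Fin n) k) :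
    (b.map φ).multiIndex s = φ ∘ b.multiIndex s := by
  funext i
  simp [OrthonormalBasis.multiIndex_apply, OrthonormalBasis.map_apply]

variable [FiniteDimensional ℝ V] [Fact (finrank ℝ V = n)]

/-- **The induced inner product on `k`-forms is invariant under isometries**: for a continuous
linear map `T` of the inner product space `V` preserving inner products,
`⟪a ∘ T, b ∘ T⟫ = ⟪a, b⟫` for the inner product `alternatingFormInner V n k` on `k`-forms — compute
the left side in the standard orthonormal basis `b` (`alternatingFormInner_apply`) and the right
side in the orthonormal basis `T ∘ b` (basis independence, `alternatingFormInner_eq_sum_holds`;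
Warner, GTM 94, Ch. 2, Ex. 13). [cite: WarnerGTM94, Ex. 2.13] -/
theorem alternatingFormInner_compContinuousLinearMap_of_inner_eq (k : ℕ) (T : V →L[ℝ] V)
    (hT : ∀ v w, ⟪T v, T w⟫ = ⟪v, w⟫) (a b : V [⋀^Fin k]→L[ℝ] ℝ) :
    alternatingFormInner V n k (a.compContinuousLinearMap T) (b.compContinuousLinearMap T) =
      alternatingFormInner V n k a b := by
  set Te : V ≃ₗᵢ[ℝ] V := ((T : V →ₗ[ℝ] V).isometryOfInner hT).toLinearIsometryEquiv rfl
  have hTe : ⇑Te = ⇑T := rfl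
  rw [alternatingFormInner_apply,
    alternatingFormInner_eq_sum_holds ((stdOrthonormalBasisFin V n).map Te)]
  refine Finset.sum_congr rfl fun s _ ↦ ?_
  simp only [ContinuousAlternatingMap.compContinuousLinearMap_apply,
    OrthonormalBasis.multiIndex_map, hTe]

end Isometry

end Literature.Geometry.Kaehler

namespace Literature.NumberTheory.Transcendental

open Literature.Geometry.Kaehler

variable {E : Type*} [NormedAddCommGroup E] [NormedSpace ℂ E]
  {M : Type*} [TopologicalSpace M] [ChartedSpace E M] {k m : ℕ}

/-! ### Weights: real and imaginary parts, inadmissible weights, `∂` and `∂̄` -/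

section Weights

/-- **Real part of a rotated form of weight `w`** at `x`: if `α(x)(e^{iθ}v) = u α(x)(v)`,
`u = e^{iwθ}`, then `Re α(x) ∘ e^{iθ} = Re u · Re α(x) - Im u · Im α(x)`. [folklore] -/
theorem re_apply_comp_tangentRotate_of_weight {w : ℤ} {α : MForm 𝓘(ℝ, E) M ℂ k} {x : M}
    (hα : ∀ (θ : ℝ) (v : Fin k → TangentSpace 𝓘(ℝ, E) x),
      α x (⇑(tangentRotate E x θ) ∘ v) = Complex.exp (w * θ * Complex.I) * α x v) (θ : ℝ) :
    (α.re x).compContinuousLinearMap (tangentRotate E x θ) =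
      (Complex.exp (w * θ * Complex.I)).re • α.re x -
        (Complex.exp (w * θ * Complex.I)).im • α.im x := by
  ext v
  simp [ContinuousAlternatingMap.compContinuousLinearMap_apply, hα, Complex.mul_re]

/-- **Imaginary part of a rotated form of weight `w`** at `x`:
`Im α(x) ∘ e^{iθ} = Re u · Im α(x) + Im u · Re α(x)`, `u = e^{iwθ}`. [folklore] -/
theorem im_apply_comp_tangentRotate_of_weight {w : ℤ} {α : MForm 𝓘(ℝ, E) M ℂ k} {x : M}
    (hα : ∀ (θ : ℝ) (v : Fin k → TangentSpace 𝓘(ℝ, E) x),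
      α x (⇑(tangentRotate E x θ) ∘ v) = Complex.exp (w * θ * Complex.I) * α x v) (θ : ℝ) :
    (α.im x).compContinuousLinearMap (tangentRotate E x θ) =
      (Complex.exp (w * θ * Complex.I)).re • α.im x +
        (Complex.exp (w * θ * Complex.I)).im • α.re x := by
  ext v
  simp [ContinuousAlternatingMap.compContinuousLinearMap_apply, hα, Complex.mul_im]

/-- The character computation behind the orthogonality of weights:
`conj(e^{iwθ}) · e^{iw'θ} = e^{iπ} = -1` for `θ = π / (w' - w)`, `w ≠ w'`. [folklore] -/
theorem conj_exp_mul_exp_eq_neg_one {w w' : ℤ} (hw : w ≠ w') :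
    starRingEnd ℂ (Complex.exp (w * (Real.pi / (w' - w) : ℝ) * Complex.I)) *
        Complex.exp (w' * (Real.pi / (w' - w) : ℝ) * Complex.I) = -1 := by
  rw [← Complex.exp_conj, ← Complex.exp_add, ← Complex.exp_pi_mul_I]
  congr 1
  have h : ((w' : ℂ) - w) ≠ 0 := by exact_mod_cast sub_ne_zero.2 hw.symm
  simp only [map_mul, map_intCast, Complex.conj_ofReal, Complex.conj_I]
  push_cast
  field_simp
  ring

/-- **A `k`-form whose weight is not an admissible frequency vanishes.** If `β` has weight `w`
at `x`, `β(x)(e^{iθ}v) = e^{iwθ} β(x)(v)`, and `w` is not of the form `p - q` with `p + q = k`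
(i.e. `|w| > k` or `w ≢ k (mod 2)`; hypothesis `hw`), then `β(x) = 0`: along a rotating frame
`θ ↦ β(x)(e^{iθ}v) = ∑_f c_f e^{ifθ}` is a trigonometric polynomial with admissible frequencies
`f` only (`MForm.exists_fourier`: `|f| ≤ k`, `f ≡ k (mod 2)`), and averaging
`e^{-iwθⱼ} β(x)(e^{iθⱼ}v)` over the `(2N+1)`-st roots of unity, `N = k + |w|`, gives `β(x)(v)` on
the one hand and `∑_f c_f · 0 = 0` on the other (`sum_exp_mul_rootAngle_mul_I_eq_zero`, all
`0 < |f - w| ≤ 2N`). Parity-sharp form of `eq_zero_of_forall_apply_comp_tangentRotate`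
(`KaehlerHodgeStarTypeProofs.lean`, the case `|w| > k`). Voisin (2002), §2.3.1 (the weights of
`Λ^k (E_ℝ)^* ⊗ ℂ` are the `p - q`, `p + q = k`). [folklore] -/
theorem apply_eq_zero_of_weight_of_forall_ne {w : ℤ} {β : MForm 𝓘(ℝ, E) M ℂ k} {x : M}
    (hβ : ∀ (θ : ℝ) (v : Fin k → TangentSpace 𝓘(ℝ, E) x),
      β x (⇑(tangentRotate E x θ) ∘ v) = Complex.exp (w * θ * Complex.I) * β x v)
    (hw : ∀ f : ℤ, f.natAbs ≤ k → (2 : ℤ) ∣ f + k → f ≠ w)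
    (v : Fin k → TangentSpace 𝓘(ℝ, E) x) : β x v = 0 := by
  obtain ⟨P, hP, hPev⟩ := β.exists_fourier x v
  set N : ℕ := k + w.natAbs with hN
  have hC : ((2 * N + 1 : ℕ) : ℂ) ≠ 0 := by exact_mod_cast Nat.succ_ne_zero (2 * N)
  -- the weighted average of `β x (e^{iθ_j} v)` over the `(2N+1)`-st roots of unity is `β x v` …
  have hS1 : ∑ j : Fin (2 * N + 1),
      Complex.exp (-((w : ℂ) * ((2 * Real.pi * j / (2 * N + 1) : ℝ) : ℂ) * Complex.I)) *
        β x (⇑(tangentRotate E x (2 * Real.pi * j / (2 * N + 1))) ∘ v) =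
      ((2 * N + 1 : ℕ) : ℂ) * β x v := by
    have hterm : ∀ j : Fin (2 * N + 1),
        Complex.exp (-((w : ℂ) * ((2 * Real.pi * j / (2 * N + 1) : ℝ) : ℂ) * Complex.I)) *
          β x (⇑(tangentRotate E x (2 * Real.pi * j / (2 * N + 1))) ∘ v) = β x v := by
      intro j
      rw [hβ, ← mul_assoc, ← Complex.exp_add, neg_add_cancel, Complex.exp_zero, one_mul]
    simp only [hterm, Finset.sum_const, Finset.card_univ, Fintype.card_fin, nsmul_eq_mul]
  -- … and `0`, frequency by frequency
  have hS2 : ∑ j : Fin (2 * N + 1),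
      Complex.exp (-((w : ℂ) * ((2 * Real.pi * j / (2 * N + 1) : ℝ) : ℂ) * Complex.I)) *
        β x (⇑(tangentRotate E x (2 * Real.pi * j / (2 * N + 1))) ∘ v) = 0 := by
    simp only [hPev, Finset.mul_sum]
    rw [Finset.sum_comm]
    refine Finset.sum_eq_zero fun f hf ↦ ?_
    have hterm : ∀ j : Fin (2 * N + 1),
        Complex.exp (-((w : ℂ) * ((2 * Real.pi * j / (2 * N + 1) : ℝ) : ℂ) * Complex.I)) *
          (P.coeff f * Complex.exp (f * ((2 * Real.pi * j / (2 * N + 1) : ℝ) : ℂ) * Complex.I)) =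
        P.coeff f * Complex.exp (((f - w : ℤ) : ℂ) * ((2 * Real.pi * j / (2 * N + 1) : ℝ) : ℂ) *
          Complex.I) := by
      intro j
      rw [mul_left_comm, ← Complex.exp_add]
      congr 2
      push_cast
      ring
    simp only [hterm, ← Finset.mul_sum]
    obtain ⟨hfk, hpar⟩ := hP f hf
    rw [sum_exp_mul_rootAngle_mul_I_eq_zero (sub_ne_zero.2 (hw f hfk hpar)) (by omega), mul_zero]
  rw [hS2] at hS1
  exact (mul_eq_zero.1 hS1.symm).resolve_left hC

/-- **A form of weight `w` is zero or of pure type**: if `β(x)(e^{iθ}v) = e^{iwθ} β(x)(v)` at every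
point, then either `β = 0` or `β` has type `(p,q)` for the (unique) `p + q = k`, `p - q = w`
(`exists_antidiagonal_sub_eq_of_natAbs_le` when `w` is admissible, else
`apply_eq_zero_of_weight_of_forall_ne`). Voisin (2002), §2.3.1. [folklore] -/
theorem eq_zero_or_exists_isOfType_of_weight {w : ℤ} {β : MForm 𝓘(ℝ, E) M ℂ k}
    (hβ : ∀ (x : M) (θ : ℝ) (v : Fin k → TangentSpace 𝓘(ℝ, E) x),
      β x (⇑(tangentRotate E x θ) ∘ v) = Complex.exp (w * θ * Complex.I) * β x v) :
    β = 0 ∨ ∃ p q : ℕ, (p : ℤ) - q = w ∧ IsOfType p q β := by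
  by_cases hk : w.natAbs ≤ k ∧ (2 : ℤ) ∣ w + k
  · right
    obtain ⟨pq, hpq, hw⟩ := exists_antidiagonal_sub_eq_of_natAbs_le hk
    refine ⟨pq.1, pq.2, hw, mem_antidiagonal.1 hpq, fun x θ v ↦ ?_⟩
    rw [hw]
    exact hβ x θ v
  · left
    funext x
    ext v
    refine apply_eq_zero_of_weight_of_forall_ne (hβ x) (fun f hf hpar hfw ↦ hk ?_) v
    subst hfw
    exact ⟨hf, hpar⟩

/-- **`∂` raises the weight by one**: if `γ` has weight `w` (at every point), `∂γ` has weight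
`w + 1` — `γ` is `0` or of type `(p,q)` with `p - q = w` (`eq_zero_or_exists_isOfType_of_weight`),
and then `∂γ` has type `(p+1,q)` (`IsOfType.dolbeault_holds`). Huybrechts (2005), Lemma 1.3.6
and Def. 3.1.3 (`∂ : A^{p,q} → A^{p+1,q}`); Voisin (2002), §2.3.3.
[cite: Huybrechts2005, Lemma 1.3.6] -/
theorem dolbeault_apply_comp_tangentRotate_of_weight {w : ℤ} {γ : MForm 𝓘(ℝ, E) M ℂ k}
    (hγ : ∀ (x : M) (θ : ℝ) (v : Fin k → TangentSpace 𝓘(ℝ, E) x),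
      γ x (⇑(tangentRotate E x θ) ∘ v) = Complex.exp (w * θ * Complex.I) * γ x v)
    (x : M) (θ : ℝ) (v : Fin (k + 1) → TangentSpace 𝓘(ℝ, E) x) :
    dolbeault γ x (⇑(tangentRotate E x θ) ∘ v) =
      Complex.exp ((w + 1 : ℤ) * θ * Complex.I) * dolbeault γ x v := by
  rcases eq_zero_or_exists_isOfType_of_weight hγ with rfl | ⟨p, q, hpq, ht⟩
  · simp
  · rw [(IsOfType.dolbeault_holds ht).apply_comp_tangentRotate x θ v]
    subst hpq
    congr 4
    push_cast
    ring

/-- **`∂̄` lowers the weight by one**: if `γ` has weight `w` (at every point), `∂̄γ` has weight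
`w - 1` (`∂̄ : A^{p,q} → A^{p,q+1}`, `IsOfType.dolbeaultBar_holds`). Huybrechts (2005), Lemma 1.3.6
and Def. 3.1.3; Voisin (2002), §2.3.3. [cite: Huybrechts2005, Lemma 1.3.6] -/
theorem dolbeaultBar_apply_comp_tangentRotate_of_weight {w : ℤ} {γ : MForm 𝓘(ℝ, E) M ℂ k}
    (hγ : ∀ (x : M) (θ : ℝ) (v : Fin k → TangentSpace 𝓘(ℝ, E) x),
      γ x (⇑(tangentRotate E x θ) ∘ v) = Complex.exp (w * θ * Complex.I) * γ x v)
    (x : M) (θ : ℝ) (v : Fin (k + 1) → TangentSpace 𝓘(ℝ, E) x) :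
    dolbeaultBar γ x (⇑(tangentRotate E x θ) ∘ v) =
      Complex.exp ((w - 1 : ℤ) * θ * Complex.I) * dolbeaultBar γ x v := by
  rcases eq_zero_or_exists_isOfType_of_weight hγ with rfl | ⟨p, q, hpq, ht⟩
  · simp
  · rw [(IsOfType.dolbeaultBar_holds ht).apply_comp_tangentRotate x θ v]
    subst hpq
    congr 4
    push_cast
    ring

end Weights

/-! ### Hermitian metrics: invariance under `e^{iθ}`, orthogonality of weights, the Hodge star -/

section Hermitian

variable [FiniteDimensional ℂ E] {n : ℕ} [Fact (finrank ℝ E = n)]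
  [RiemannianBundle (fun x : M ↦ TangentSpace 𝓘(ℝ, E) x)]

/-- **The induced inner product on real forms is invariant under the rotations `e^{iθ}`** of a
Hermitian metric (pointwise at `x`): `⟪a ∘ e^{iθ}, b ∘ e^{iθ}⟫ = ⟪a, b⟫`
(`alternatingFormInner_compContinuousLinearMap_of_inner_eq` with
`inner_tangentRotate_tangentRotate`). Huybrechts (2005), §1.2 (the Hermitian form on `Λ^* V_ℂ^*`
is `U(1)`-invariant; used for Lemma 1.2.24 (i)). [folklore] -/
theorem alternatingFormInner_comp_tangentRotate {x : M}
    (hH : ∀ v w : TangentSpace 𝓘(ℝ, E) x, ⟪tangentJ E x v, tangentJ E x w⟫ = ⟪v, w⟫)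
    (θ : ℝ) (a b : TangentSpace 𝓘(ℝ, E) x [⋀^Fin k]→L[ℝ] ℝ) :
    alternatingFormInner (TangentSpace 𝓘(ℝ, E) x) n k
        (a.compContinuousLinearMap (tangentRotate E x θ))
        (b.compContinuousLinearMap (tangentRotate E x θ)) =
      alternatingFormInner (TangentSpace 𝓘(ℝ, E) x) n k a b :=
  alternatingFormInner_compContinuousLinearMap_of_inner_eq k _
    (inner_tangentRotate_tangentRotate hH θ) a b

/-- **Orthogonality of the weight (bidegree) decomposition for a Hermitian metric**, pointwise
(Huybrechts (2005), Lemma 1.2.24 (i), p. 33: "`⊕ Λ^{p,q} V^*` is orthogonal with respect to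
`⟨ , ⟩_ℂ`"; Prop. 3.2.2 (ii), p. 125). If the complex `k`-forms `α`, `β` have weights `w ≠ w'` at
`x`, then the pointwise Hermitian product
`⟨α, β⟩_x = (⟨Re α, Re β⟩ + ⟨Im α, Im β⟩) + i (⟨Re α, Im β⟩ - ⟨Im α, Re β⟩)` (conjugate-linear
in the first slot; the integrand of `MForm.cl2Inner`) vanishes, i.e. both real combinations
vanish.
Proof as in the module docstring: `⟨α, β⟩_x = conj(u) u' ⟨α, β⟩_x` for `u = e^{iwθ}`,
`u' = e^{iw'θ}` by `U(1)`-invariance (`alternatingFormInner_comp_tangentRotate`), and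
`conj(u) u' = -1` for `θ = π/(w' - w)` (`conj_exp_mul_exp_eq_neg_one`).
[cite: Huybrechts2005, Lemma 1.2.24 (i)] -/
theorem inner_re_im_eq_zero_of_weight_ne
    (hH : ∀ (x : M) (v w : TangentSpace 𝓘(ℝ, E) x), ⟪tangentJ E x v, tangentJ E x w⟫ = ⟪v, w⟫)
    {w w' : ℤ} (hw : w ≠ w') {α β : MForm 𝓘(ℝ, E) M ℂ k} {x : M}
    (hα : ∀ (θ : ℝ) (v : Fin k → TangentSpace 𝓘(ℝ, E) x),
      α x (⇑(tangentRotate E x θ) ∘ v) = Complex.exp (w * θ * Complex.I) * α x v)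
    (hβ : ∀ (θ : ℝ) (v : Fin k → TangentSpace 𝓘(ℝ, E) x),
      β x (⇑(tangentRotate E x θ) ∘ v) = Complex.exp (w' * θ * Complex.I) * β x v) :
    MForm.inner n α.re β.re x + MForm.inner n α.im β.im x = 0 ∧
      MForm.inner n α.re β.im x - MForm.inner n α.im β.re x = 0 := by
  set θ : ℝ := Real.pi / (w' - w) with hθ
  set u : ℂ := Complex.exp (w * θ * Complex.I) with hu
  set u' : ℂ := Complex.exp (w' * θ * Complex.I) with hu'
  have hprod : starRingEnd ℂ u * u' = -1 := conj_exp_mul_exp_eq_neg_one hw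
  have hre : u.re * u'.re + u.im * u'.im = -1 := by
    have h := congrArg Complex.re hprod
    simp only [Complex.mul_re, Complex.conj_re, Complex.conj_im, Complex.neg_re,
      Complex.one_re] at h
    linarith
  have him : u.re * u'.im - u.im * u'.re = 0 := by
    have h := congrArg Complex.im hprod
    simp only [Complex.mul_im, Complex.conj_re, Complex.conj_im, Complex.neg_im,
      Complex.one_im] at h
    linarith
  -- `U(1)`-invariance of the four real pairings, expanded bilinearly
  have h1 := alternatingFormInner_comp_tangentRotate (k := k) (n := n) (hH x) θ (α.re x) (β.re x)
  have h2 := alternatingFormInner_comp_tangentRotate (k := k) (n := n) (hH x) θ (α.im x) (β.im x)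
  have h3 := alternatingFormInner_comp_tangentRotate (k := k) (n := n) (hH x) θ (α.re x) (β.im x)
  have h4 := alternatingFormInner_comp_tangentRotate (k := k) (n := n) (hH x) θ (α.im x) (β.re x)
  rw [re_apply_comp_tangentRotate_of_weight hα, re_apply_comp_tangentRotate_of_weight hβ] at h1
  rw [im_apply_comp_tangentRotate_of_weight hα, im_apply_comp_tangentRotate_of_weight hβ] at h2
  rw [re_apply_comp_tangentRotate_of_weight hα, im_apply_comp_tangentRotate_of_weight hβ] at h3
  rw [im_apply_comp_tangentRotate_of_weight hα, re_apply_comp_tangentRotate_of_weight hβ] at h4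
  simp only [map_sub, map_add, map_smul, LinearMap.sub_apply, LinearMap.add_apply,
    LinearMap.smul_apply, smul_eq_mul] at h1 h2 h3 h4
  simp only [MForm.inner]
  set A := alternatingFormInner (TangentSpace 𝓘(ℝ, E) x) n k (α.re x) (β.re x)
  set B := alternatingFormInner (TangentSpace 𝓘(ℝ, E) x) n k (α.im x) (β.im x)
  set C := alternatingFormInner (TangentSpace 𝓘(ℝ, E) x) n k (α.re x) (β.im x)
  set D := alternatingFormInner (TangentSpace 𝓘(ℝ, E) x) n k (α.im x) (β.re x)
  constructor
  · linear_combination (-(1 : ℝ) / 2) * h1 + (-(1 : ℝ) / 2) * h2 + ((A + B) / 2) * hre +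
      (-(C - D) / 2) * him
  · linear_combination (-(1 : ℝ) / 2) * h3 + ((1 : ℝ) / 2) * h4 + ((C - D) / 2) * hre +
      ((A + B) / 2) * him

variable (o : (x : M) → Orientation ℝ (TangentSpace 𝓘(ℝ, E) x) (Fin n))

/-- **The `ℂ`-linear Hodge star of a Hermitian metric preserves weights** (Huybrechts (2005),
Lemma 1.2.24 (ii), p. 33: `*` maps `Λ^{p,q}` to `Λ^{n-q,n-p}`, both of weight `p - q`), in integer
weight form at a point: if `β(x)(e^{iθ}v) = e^{iwθ} β(x)(v)` for all `θ, v`, the same holds for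
`⋆β`. The real star commutes with the orientation-preserving isometries `e^{iθ}`
(`hodgeStar_compContinuousLinearMap_tangentRotate`) and the complex star is its `ℂ`-linear
extension (`MForm.cHodgeStar_apply`). Integer-weight companion of
`IsOfType.cHodgeStar_apply_comp_tangentRotate`. [cite: Huybrechts2005, Lemma 1.2.24 (ii)] -/
theorem cHodgeStar_apply_comp_tangentRotate_of_weight
    (hH : ∀ (x : M) (v w : TangentSpace 𝓘(ℝ, E) x), ⟪tangentJ E x v, tangentJ E x w⟫ = ⟪v, w⟫)
    (h : k + m = n) {w : ℤ} {β : MForm 𝓘(ℝ, E) M ℂ k} {x : M}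
    (hβ : ∀ (θ : ℝ) (v : Fin k → TangentSpace 𝓘(ℝ, E) x),
      β x (⇑(tangentRotate E x θ) ∘ v) = Complex.exp (w * θ * Complex.I) * β x v)
    (θ : ℝ) (v : Fin m → TangentSpace 𝓘(ℝ, E) x) :
    MForm.cHodgeStar o h β x (⇑(tangentRotate E x θ) ∘ v) =
      Complex.exp (w * θ * Complex.I) * MForm.cHodgeStar o h β x v := by
  have hr := hodgeStar_compContinuousLinearMap_tangentRotate o (hH x) h θ (β.re x)
  have hi := hodgeStar_compContinuousLinearMap_tangentRotate o (hH x) h θ (β.im x)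
  rw [re_apply_comp_tangentRotate_of_weight hβ] at hr
  rw [im_apply_comp_tangentRotate_of_weight hβ] at hi
  have hr' := congrArg (fun f ↦ f v) hr
  have hi' := congrArg (fun f ↦ f v) hi
  simp only [map_sub, map_add, map_smul, ContinuousAlternatingMap.sub_apply,
    ContinuousAlternatingMap.add_apply, ContinuousAlternatingMap.smul_apply,
    ContinuousAlternatingMap.compContinuousLinearMap_apply, smul_eq_mul] at hr' hi'
  simp only [MForm.cHodgeStar_apply, Pi.add_apply, Pi.smul_apply,
    ContinuousAlternatingMap.add_apply, ContinuousAlternatingMap.smul_apply, MForm.ofReal_apply,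
    MForm.hodgeStar_apply, smul_eq_mul]
  rw [← hr', ← hi']
  apply Complex.ext
  · simp [Complex.mul_re]
  · simp [Complex.mul_im]

end Hermitian

end Literature.NumberTheory.Transcendental
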